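import Mathlib
import HarnessLib
import Summits.RiemannHypothesis.RiemannHypothesis.Theorems.DbrWallAntipersistenceConcave
import Literature.Probability.LatticeModels.PlanarIsingWuDiag

/-!
# DBR column, rung B-P(P1): anti-persistence of the zeta screw line THROUGH THE FIRST PRIME —
# `Ψ(2s) < 2Ψ(s)` for every `0 < s ≤ (log 3)/2`

RH-FREE calculus inequality (LINE 1 of the label discipline): a theorem about the explicit closed form (1.1) of
Suzuki's screw function `Ψ = Literature.NumberTheory.LFunctions.zetaScrew` with its first prime term
`Λ(2)2^{−1/2}(t − log 2)₊`; NOT worded as, and not, progress toward RH («`Ψ(2s) < 2Ψ(s)` for all `s > 0`» stays a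
conjecture from data).

This file extends `DbrWallAntipersistence` (p440661, the prime-free wall `0 < s ≤ (log 2)/2`) to the window of the
tree's first Weil-positivity rung, `0 < s ≤ (log 3)/2` (`zetaScrew_two_mul_lt_two_mul_of_le_half_log_three`), i.e.
the first Levinson reflection coefficient `κ₁(s) = 1 − Ψ(2s)/(2Ψ(s))` of the mesh-`s` lattice screw line stays positive
while the prime `2` (and only it) acts on `Ψ(2s)` (`kappaOne_pos_of_le_half_log_three`).

Method [folklore]: on `[(log 2)/2, (log 3)/2]`, `2Ψ(s) − Ψ(2s) = F(s) := D(s) + (log 2/√2)(2s − log 2)`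
(`two_mul_zetaScrew_sub_eq_gap_add_prime`) and `F` is CONCAVE there (`gap_add_prime_concave`), so
`F ≥ min(F((log 2)/2), F((log 3)/2))`; `F((log 2)/2) = D((log 2)/2) > 0` is p440661's certificate
(`gap_half_log_two_pos`) and `F((log 3)/2) > 0` is ONE more rational certificate (`gap_add_prime_half_log_three_pos`):
at `s₁ = (log 3)/2` every exponential is a power of `ρ = 3^{1/4}` (`1.316074 < ρ < 1.316075`,
`e^{−λ'_k s₁} = ρ⁻¹·3^{−(k+1)}`), twenty terms of the series plus the telescoping tail `Σ_{k≥20} λ'_k⁻² ≥ 1/85` (`hasSum_telescope`) give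
`D(s₁) ≥ 0.2186 − 0.3997 = −0.1811`, while `(log 2/√2)·log(3/2) > 0.1986` (`log 2 > 0.6931471803` from Mathlib,
`log(3/2) > 0.40538` from ten terms of `−log(1 − 1/3)`, `√2 < 1.41422`); numerically `F(s₁) = 0.01795`, and the
certificate margin is `0.0177`. (The archimedean gap alone is `−0.181` there: past the wall it is the prime `2` that
keeps the lattice screw line anti-persistent, cf. `DbrWallAntipersistenceSharp`.) References: M. Suzuki, J. Lond.
Math. Soc. (2) 108 (2023) = arXiv:2206.03682, (1.1) [Suzuki2023]. Nothing here bears on the truth of RH. -/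

set_option linter.dupNamespace false

noncomputable section

open scoped BigOperators
open Set
namespace Summit.RiemannHypothesis.RiemannHypothesis.Theorems.DbrWall

open Literature.NumberTheory.LFunctions

/-! ### Arithmetic of `ρ = 3^{1/4}` -/

/-- `ρ := e^{(log 3)/4} = 3^{1/4}` satisfies `ρ⁴ = 3`. [folklore] -/
theorem exp_log_three_div_four_pow_four : Real.exp (Real.log 3 / 4) ^ 4 = 3 := by
  rw [← Real.exp_nat_mul, show ((4 : ℕ) : ℝ) * (Real.log 3 / 4) = Real.log 3 by push_cast; ring,
    Real.exp_log (by norm_num)]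

/-- `1.316074 < 3^{1/4} < 1.316075`. [folklore] -/
theorem exp_log_three_div_four_bounds :
    (1.316074 : ℝ) < Real.exp (Real.log 3 / 4) ∧ Real.exp (Real.log 3 / 4) < 1.316075 := by
  set r := Real.exp (Real.log 3 / 4) with hr
  have hr0 : 0 < r := Real.exp_pos _
  have hr4 := exp_log_three_div_four_pow_four
  constructor
  · by_contra h
    push Not at h
    have := pow_le_pow_left₀ hr0.le h 4
    rw [hr4] at this
    norm_num at this
  · by_contra h
    push Not at h
    have := pow_le_pow_left₀ (by norm_num) h 4
    rw [hr4] at this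
    norm_num at this

/-- The gap exponentials at `s₁ = (log 3)/2`: `e^{−λ'_k s₁} = 3^{−(k+1)}·ρ⁻¹`. [folklore] -/
theorem exp_neg_lam_mul_half_log_three (k : ℕ) :
    Real.exp (-((2 * (k : ℝ) + 5 / 2) * (Real.log 3 / 2)))
      = (1 / 3 : ℝ) ^ (k + 1) * (Real.exp (Real.log 3 / 4))⁻¹ := by
  set r := Real.exp (Real.log 3 / 4) with hr
  have hr4 := exp_log_three_div_four_pow_four
  have h1 : Real.exp (-((2 * (k : ℝ) + 5 / 2) * (Real.log 3 / 2))) = r⁻¹ ^ (4 * k + 5) := by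
    rw [show (2 * (k : ℝ) + 5 / 2) * (Real.log 3 / 2) = ((4 * k + 5 : ℕ) : ℝ) * (Real.log 3 / 4) by
      push_cast; ring, Real.exp_neg, Real.exp_nat_mul, inv_pow]
  have h2 : r⁻¹ ^ (4 * k + 5) = (r⁻¹ ^ 4) ^ (k + 1) * r⁻¹ := by ring
  have h3 : r⁻¹ ^ 4 = 1 / 3 := by rw [inv_pow, hr4, one_div]
  rw [h1, h2, h3]

/-! ### Elementary bounds: `log(3/2)` and the prime term -/

/-- `log(3/2) > 0.40538` (ten terms of `−log(1 − 1/3) = Σ (1/3)ⁿ/n`, `Real.abs_log_sub_add_sum_range_le`). [folklore] -/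
theorem log_three_halves_gt : (0.40538 : ℝ) < Real.log (3 / 2) := by
  have hx : |(1 / 3 : ℝ)| < 1 := by rw [abs_of_pos (by norm_num)]; norm_num
  have h := Real.abs_log_sub_add_sum_range_le hx 10
  have hlog : Real.log (1 - 1 / 3 : ℝ) = -Real.log (3 / 2) := by
    rw [show (1 - 1 / 3 : ℝ) = (3 / 2)⁻¹ by norm_num, Real.log_inv]
  rw [hlog, abs_of_pos (by norm_num : (0 : ℝ) < 1 / 3)] at h
  have h' := (abs_le.1 h).2
  simp only [Finset.sum_range_succ, Finset.sum_range_zero] at h'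
  norm_num at h'
  linarith

/-- The prime term at `s₁ = (log 3)/2`: `(log 2/√2)(2s₁ − log 2) = (log 2/√2)·log(3/2) > 0.19868`. [folklore] -/
theorem prime_term_half_log_three_gt :
    (0.19868 : ℝ) < Real.log 2 / Real.sqrt 2 * (2 * (Real.log 3 / 2) - Real.log 2) := by
  have h32 : 2 * (Real.log 3 / 2) - Real.log 2 = Real.log (3 / 2) := by
    rw [Real.log_div (by norm_num) (by norm_num)]; ring
  rw [h32]
  have hl2 := Real.log_two_gt_d9
  have hl32 := log_three_halves_gt
  have hs0 : 0 < Real.sqrt 2 := Real.sqrt_pos.2 (by norm_num)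
  have hs2 : Real.sqrt 2 < 1.41422 := by
    have h := Real.sq_sqrt (show (0 : ℝ) ≤ 2 by norm_num)
    nlinarith [Real.sqrt_nonneg 2]
  have hprod : (0.6931471803 : ℝ) * 0.40538 ≤ Real.log 2 * Real.log (3 / 2) :=
    mul_le_mul hl2.le hl32.le (by norm_num) (by linarith)
  rw [div_mul_eq_mul_div, lt_div_iff₀ hs0]
  nlinarith

/-! ### The certificate at `s₁ = (log 3)/2` -/

/-- **`F((log 3)/2) > 0`**: `D((log 3)/2) + (log 2/√2)·log(3/2) > 0` in certificate form (twenty exact terms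
`≥ 0.20686`, tail `≥ 0.01176`, `4(3^{1/4} − 1)² < 0.39962`, prime term `> 0.19868`; numerically `F = 0.01795`).
[folklore] -/
theorem gap_add_prime_half_log_three_pos :
    0 < (∑' k : ℕ, (1 - Real.exp (-((2 * (k : ℝ) + 5 / 2) * (Real.log 3 / 2)))) ^ 2
            / (2 * (k : ℝ) + 5 / 2) ^ 2)
        - 4 * (Real.exp (Real.log 3 / 2 / 2) - 1) ^ 2
        + Real.log 2 / Real.sqrt 2 * (2 * (Real.log 3 / 2) - Real.log 2) := by
  set r := Real.exp (Real.log 3 / 4) with hr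
  have hr0 : 0 < r := Real.exp_pos _
  obtain ⟨hr_lo, hr_hi⟩ := exp_log_three_div_four_bounds
  have hrinv : r⁻¹ ≤ 0.75984 := by
    rw [inv_eq_one_div, div_le_iff₀ hr0]; nlinarith
  have hrinv1 : r⁻¹ ≤ 1 := by
    rw [inv_eq_one_div, div_le_iff₀ hr0]; nlinarith
  have hrinv0 : 0 ≤ r⁻¹ := by positivity
  have hs0 : (0 : ℝ) ≤ Real.log 3 / 2 := by
    have := Real.log_nonneg (show (1 : ℝ) ≤ 3 by norm_num); positivity
  rw [show Real.log 3 / 2 / 2 = Real.log 3 / 4 by ring]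
  simp only [exp_neg_lam_mul_half_log_three]
  have hS : Summable fun k : ℕ =>
      (1 - (1 / 3 : ℝ) ^ (k + 1) * r⁻¹) ^ 2 / (2 * (k : ℝ) + 5 / 2) ^ 2 := by
    have := summable_gap_terms hs0
    simp only [exp_neg_lam_mul_half_log_three] at this
    exact this
  rw [← hS.sum_add_tsum_nat_add 20]
  -- twenty terms
  have hterm : ∀ k : ℕ, (1 - (1 / 3 : ℝ) ^ (k + 1) * 0.75984) ^ 2 / (2 * (k : ℝ) + 5 / 2) ^ 2
      ≤ (1 - (1 / 3 : ℝ) ^ (k + 1) * r⁻¹) ^ 2 / (2 * (k : ℝ) + 5 / 2) ^ 2 := by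
    intro k
    apply div_le_div_of_nonneg_right _ (by positivity)
    have hq0 : 0 ≤ (1 / 3 : ℝ) ^ (k + 1) := by positivity
    have hq1 : (1 / 3 : ℝ) ^ (k + 1) ≤ 1 := pow_le_one₀ (by norm_num) (by norm_num)
    have hlo : 0 ≤ 1 - (1 / 3 : ℝ) ^ (k + 1) * 0.75984 := by nlinarith
    have hle : 1 - (1 / 3 : ℝ) ^ (k + 1) * 0.75984 ≤ 1 - (1 / 3 : ℝ) ^ (k + 1) * r⁻¹ := by
      nlinarith [mul_le_mul_of_nonneg_left hrinv hq0]
    exact pow_le_pow_left₀ hlo hle 2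
  have hnum : (0.20686 : ℝ) ≤
      ∑ k ∈ Finset.range 20, (1 - (1 / 3 : ℝ) ^ (k + 1) * 0.75984) ^ 2 / (2 * (k : ℝ) + 5 / 2) ^ 2 := by
    simp only [Finset.sum_range_succ, Finset.sum_range_zero]
    norm_num
  have hhead : (0.20686 : ℝ) ≤
      ∑ k ∈ Finset.range 20, (1 - (1 / 3 : ℝ) ^ (k + 1) * r⁻¹) ^ 2 / (2 * (k : ℝ) + 5 / 2) ^ 2 :=
    hnum.trans (Finset.sum_le_sum fun k _ => hterm k)
  -- the tail `Σ_{k ≥ 20} ≥ (1 − 3^{−21})²/85` by telescoping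
  -- generic telescoping lemma `Σ_j 1/((j+m)(j+m+1)) = 1/m` (it lives in the tree's Ising file)
  have hT := Literature.Probability.LatticeModels.hasSum_telescope (show (0 : ℝ) < 85 / 4 by norm_num)
  have hTs : Summable fun k : ℕ =>
      (1 - (1 / 3 : ℝ) ^ 21) ^ 2 / 4 * (1 / (((k : ℝ) + 85 / 4) * ((k : ℝ) + 85 / 4 + 1))) :=
    (hT.mul_left _).summable
  have hTval : ∑' k : ℕ, (1 - (1 / 3 : ℝ) ^ 21) ^ 2 / 4 * (1 / (((k : ℝ) + 85 / 4) * ((k : ℝ) + 85 / 4 + 1)))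
      = (1 - (1 / 3 : ℝ) ^ 21) ^ 2 / 4 * (1 / (85 / 4)) := (hT.mul_left _).tsum_eq
  have htail : ∑' k : ℕ, (1 - (1 / 3 : ℝ) ^ 21) ^ 2 / 4 * (1 / (((k : ℝ) + 85 / 4) * ((k : ℝ) + 85 / 4 + 1)))
      ≤ ∑' k : ℕ, (1 - (1 / 3 : ℝ) ^ (k + 20 + 1) * r⁻¹) ^ 2 / (2 * ((k + 20 : ℕ) : ℝ) + 5 / 2) ^ 2 := by
    refine hTs.tsum_le_tsum (fun k => ?_) ((summable_nat_add_iff 20).2 hS)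
    have hq0 : 0 ≤ (1 / 3 : ℝ) ^ (k + 20 + 1) * r⁻¹ := by positivity
    have hq1 : (1 / 3 : ℝ) ^ (k + 20 + 1) * r⁻¹ ≤ (1 / 3 : ℝ) ^ 21 := by
      have h1 : (1 / 3 : ℝ) ^ (k + 20 + 1) ≤ (1 / 3 : ℝ) ^ 21 :=
        pow_le_pow_of_le_one (by norm_num) (by norm_num) (by omega)
      have h2 : (1 / 3 : ℝ) ^ (k + 20 + 1) * r⁻¹ ≤ (1 / 3 : ℝ) ^ (k + 20 + 1) * 1 :=
        mul_le_mul_of_nonneg_left hrinv1 (by positivity)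
      linarith
    have hnum0 : 0 ≤ 1 - (1 / 3 : ℝ) ^ 21 := by norm_num
    have hnum1 : (1 - (1 / 3 : ℝ) ^ 21) ^ 2 ≤ (1 - (1 / 3 : ℝ) ^ (k + 20 + 1) * r⁻¹) ^ 2 :=
      pow_le_pow_left₀ hnum0 (by linarith) 2
    have hk : (0 : ℝ) ≤ k := Nat.cast_nonneg k
    have hden : (2 * ((k + 20 : ℕ) : ℝ) + 5 / 2) ^ 2 ≤ 4 * (((k : ℝ) + 85 / 4) * ((k : ℝ) + 85 / 4 + 1)) := by
      push_cast; nlinarith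
    have hden0 : 0 < (2 * ((k + 20 : ℕ) : ℝ) + 5 / 2) ^ 2 := by positivity
    rw [show (1 - (1 / 3 : ℝ) ^ 21) ^ 2 / 4 * (1 / (((k : ℝ) + 85 / 4) * ((k : ℝ) + 85 / 4 + 1)))
        = (1 - (1 / 3 : ℝ) ^ 21) ^ 2 / (4 * (((k : ℝ) + 85 / 4) * ((k : ℝ) + 85 / 4 + 1))) by
      field_simp]
    exact div_le_div₀ (by positivity) hnum1 hden0 hden
  rw [hTval] at htail
  have htailnum : (0.01176 : ℝ) ≤ (1 - (1 / 3 : ℝ) ^ 21) ^ 2 / 4 * (1 / (85 / 4)) := by norm_num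
  -- the subtracted term and the prime term
  have hsub : 4 * (r - 1) ^ 2 < 0.39962 := by nlinarith
  have hprime := prime_term_half_log_three_gt
  linarith

/-! ### Assembly -/

/-- **Anti-persistence on `[(log 2)/2, (log 3)/2]`** (the prime `2` acting): `Ψ(2s) < 2Ψ(s)`. By concavity of
`F = D + prime term` between the two certified end-points. [folklore] -/
theorem zetaScrew_two_mul_lt_two_mul_of_half_log_two_le {s : ℝ} (h0 : Real.log 2 / 2 ≤ s)
    (h1 : s ≤ Real.log 3 / 2) : zetaScrew (2 * s) < 2 * zetaScrew s := by
  have hl2 : 0 < Real.log 2 := Real.log_pos one_lt_two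
  have h23 : Real.log 2 < Real.log 3 := Real.log_lt_log (by norm_num) (by norm_num)
  set s₀ : ℝ := Real.log 2 / 2 with hs₀
  set s₁ : ℝ := Real.log 3 / 2 with hs₁
  have hd : 0 < s₁ - s₀ := by rw [hs₀, hs₁]; linarith
  set a : ℝ := (s₁ - s) / (s₁ - s₀) with ha
  set b : ℝ := (s - s₀) / (s₁ - s₀) with hb
  have ha0 : 0 ≤ a := div_nonneg (by linarith) hd.le
  have hb0 : 0 ≤ b := div_nonneg (by linarith) hd.le
  have hab : a + b = 1 := by rw [ha, hb, ← add_div, div_eq_one_iff_eq hd.ne']; ring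
  have hs : a * s₀ + b * s₁ = s := by
    rw [ha, hb]; field_simp; ring
  have hc := gap_add_prime_concave (x := s₀) (y := s₁) (le_refl _) (by linarith) ha0 hb0 hab
  rw [hs] at hc
  have hF0 : 0 < (∑' k : ℕ, (1 - Real.exp (-((2 * (k : ℝ) + 5 / 2) * s₀))) ^ 2 / (2 * (k : ℝ) + 5 / 2) ^ 2)
      - 4 * (Real.exp (s₀ / 2) - 1) ^ 2 + Real.log 2 / Real.sqrt 2 * (2 * s₀ - Real.log 2) := by
    have h := gap_half_log_two_pos
    have hz : Real.log 2 / Real.sqrt 2 * (2 * s₀ - Real.log 2) = 0 := by rw [hs₀]; ring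
    rw [hz, add_zero]
    exact h
  have hF1 : 0 < (∑' k : ℕ, (1 - Real.exp (-((2 * (k : ℝ) + 5 / 2) * s₁))) ^ 2 / (2 * (k : ℝ) + 5 / 2) ^ 2)
      - 4 * (Real.exp (s₁ / 2) - 1) ^ 2 + Real.log 2 / Real.sqrt 2 * (2 * s₁ - Real.log 2) :=
    gap_add_prime_half_log_three_pos
  have hid := two_mul_zetaScrew_sub_eq_gap_add_prime (s := s) (by rw [hs₀] at h0; linarith)
    (by rw [hs₁] at h1; linarith)
  -- `a·F(s₀) + b·F(s₁) > 0`
  have hmin : 0 < a * ((∑' k : ℕ, (1 - Real.exp (-((2 * (k : ℝ) + 5 / 2) * s₀))) ^ 2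
        / (2 * (k : ℝ) + 5 / 2) ^ 2)
      - 4 * (Real.exp (s₀ / 2) - 1) ^ 2 + Real.log 2 / Real.sqrt 2 * (2 * s₀ - Real.log 2))
      + b * ((∑' k : ℕ, (1 - Real.exp (-((2 * (k : ℝ) + 5 / 2) * s₁))) ^ 2
        / (2 * (k : ℝ) + 5 / 2) ^ 2)
      - 4 * (Real.exp (s₁ / 2) - 1) ^ 2 + Real.log 2 / Real.sqrt 2 * (2 * s₁ - Real.log 2)) := by
    rcases le_total a b with hab' | hab'
    · have hb2 : 1 / 2 ≤ b := by linarith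
      nlinarith [mul_nonneg ha0 hF0.le, mul_le_mul_of_nonneg_right hb2 hF1.le]
    · have ha2 : 1 / 2 ≤ a := by linarith
      nlinarith [mul_nonneg hb0 hF1.le, mul_le_mul_of_nonneg_right ha2 hF0.le]
  linarith

/-- **Anti-persistence of the zeta screw line through the first prime** (RH-FREE calculus inequality):
`Ψ(2s) < 2Ψ(s)` for every `0 < s ≤ (log 3)/2`. [folklore] -/
theorem zetaScrew_two_mul_lt_two_mul_of_le_half_log_three {s : ℝ} (hs0 : 0 < s)
    (hs : s ≤ Real.log 3 / 2) : zetaScrew (2 * s) < 2 * zetaScrew s := by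
  rcases le_total s (Real.log 2 / 2) with h | h
  · exact zetaScrew_two_mul_lt_two_mul hs0 h
  · exact zetaScrew_two_mul_lt_two_mul_of_half_log_two_le h hs

/-- The same in the window variable: `Ψ(t) < 2Ψ(t/2)` for every `0 < t ≤ log 3`. [folklore] -/
theorem zetaScrew_lt_two_mul_zetaScrew_half_of_le_log_three {t : ℝ} (ht0 : 0 < t) (ht : t ≤ Real.log 3) :
    zetaScrew t < 2 * zetaScrew (t / 2) := by
  have h := zetaScrew_two_mul_lt_two_mul_of_le_half_log_three (s := t / 2) (by positivity) (by linarith)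
  rwa [show 2 * (t / 2) = t by ring] at h

/-- **`κ₁(s) > 0` through the first prime**: `0 < 1 − Ψ(2s)/(2Ψ(s))` for `0 < s ≤ (log 3)/2` (unconditionally:
`Ψ(s) > 0` there since `(log 3)/2 < log 2`, `Suzuki2023Thm41.zetaScrew_pos_of_le_log_two`). [folklore] -/
theorem kappaOne_pos_of_le_half_log_three {s : ℝ} (hs0 : 0 < s) (hs : s ≤ Real.log 3 / 2) :
    0 < 1 - zetaScrew (2 * s) / (2 * zetaScrew s) := by
  have h := zetaScrew_two_mul_lt_two_mul_of_le_half_log_three hs0 hs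
  have h34 : Real.log 3 < 2 * Real.log 2 := by
    have h' : Real.log 3 < Real.log 4 := Real.log_lt_log (by norm_num) (by norm_num)
    have h4 : Real.log 4 = 2 * Real.log 2 := by
      rw [show (4 : ℝ) = 2 ^ 2 by norm_num, Real.log_pow]; norm_num
    linarith
  have hpos : 0 < zetaScrew s := Suzuki2023Thm41.zetaScrew_pos_of_le_log_two hs0 (by linarith)
  have h2 : 0 < 2 * zetaScrew s := by linarith
  rw [sub_pos, div_lt_one h2]
  exact h

end Summit.RiemannHypothesis.RiemannHypothesis.Theorems.DbrWall
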